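import Literature.RepresentationTheory.Semisimple.EquivOfCharacter
import Mathlib.RingTheory.SimpleModule.Basic
import Mathlib.Tactic.NoncommRing
import HarnessLib

/-!
# Ring 2 hypotheses, descent face — CANCELLATION OF MURRAY–VON NEUMANN EQUIVALENT IDEMPOTENTS IN A FINITE-DIMENSIONAL
# SEMISIMPLE ALGEBRA OVER A FIELD OF CHARACTERISTIC ZERO (pure algebra, via Brauer–Nesbitt trace characters)

research route conditional on HC_CM; not a corollary; Q11.4-sentence-2 already refuted in dim ≥ 3.
Cell `pub-hodge-ring2` (Hodge ladder STAGE 3), seat `ring2-b05` (binder row b05 `Ring2.Hypotheses.MotivatedImpliesAlgebraicAV`,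
published modulo X = `Ring2.AbelianAll.LefschetzBCompactPencils`), gen 47, second file (pure algebra; the TOOL behind the third file's
cancellation of algebraic idempotents under `B(X)` and the fourth file's `B⋆(𝒴) ⟹` middle-block inverses (R₁)). `HC_CM`
(`Theses.RankFourFaces.CMAbelianHodge`) does not occur in this file; nothing geometric is proved here; no node of the cell moves.

WHAT IS PROVED (theorems only; no definition, no named fact, no sorry). `A` a ring and `k`-algebra; for an idempotent `e` the left
ideal `A·e = Ideal.span {e}` (Mathlib's `Ideal` of a non-commutative ring is a LEFT ideal) is an `A`-module, finite-dimensional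
over `k` when `A` is.
* `mem_span_singleton_of_idem` — `x ∈ A·e ↔ x e = x`.
* `nonempty_linearEquiv_span_of_equivalent` — Murray–von Neumann equivalent idempotents (`c ∈ eAf`, `c' ∈ fAe`, `cc' = e`, `c'c = f`)
  have `A`-isomorphic left ideals (`x ↦ xc`, `y ↦ yc'`).
* `nonempty_linearEquiv_prod_span` — for orthogonal idempotents `A·(e+f) ≅ A·e × A·f`; hence `trace_smul_span_add`: the trace
  CHARACTER `r ↦ Tr_k(r · | A·e)` is additive.
* **`exists_equivalent_middle_of_traces`** — `A` finite-dimensional SEMISIMPLE over `k` of characteristic `0`; `E ⊒ e₀ ⊥ e₂` and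
  `F ⊒ f₀ ⊥ f₂` idempotents, `e₁ := E - e₀ - e₂`, `f₁ := F - f₀ - f₂`; if `E ~ F`, `e₀ ~ f₂`, `e₂ ~ f₀` then `e₁ ~ f₁`
  (`x ∈ e₁Af₁`, `y ∈ f₁Ae₁`, `xy = e₁`, `yx = f₁`). Proof: the characters of `A·e₁` and `A·f₁` agree by additivity and
  invariance, so Bourbaki's corollary (*Algèbre* VIII §20 n°6 Cor. a): semisimple modules of finite dimension over a field of
  characteristic `0` with equal characters are isomorphic — the tree's `Module.nonempty_linearEquiv_of_trace_smul_eq`,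
  `Literature.RepresentationTheory.Semisimple.EquivOfCharacter`) gives `A·e₁ ≅ A·f₁`; the images of the generators are `x`, `y`.
References: BourbakiAlgebreVIII2012 (VIII §20 n°6, Prop. 6 and Cor. a), pp. 375–376); Jannsen1992 (Thm. 1, where the
semisimple algebra of the application comes from).
-/

noncomputable section

-- every declaration of this problem lives in `Summit.HodgeConjecture.HodgeConjecture.…` (summit = sub-problem)
set_option linter.dupNamespace false

open Literature.RepresentationTheory.Semisimple

namespace Summit.HodgeConjecture.HodgeConjecture.Theorems

/-! ## §1 Pure algebra: cancellation of equivalent idempotents via trace characters -/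

section Algebra

variable {k : Type*} [Field k] {A : Type*} [Ring A] [Algebra k A]

/-- For an idempotent `e`, the left ideal `A·e` is `{x | x e = x}`. [folklore] -/
theorem mem_span_singleton_of_idem {e : A} (he : e * e = e) {x : A} : x ∈ Ideal.span ({e} : Set A) ↔ x * e = x := by
  rw [Ideal.mem_span_singleton']
  exact ⟨fun ⟨a, ha⟩ ↦ by rw [← ha, mul_assoc, he], fun hx ↦ ⟨x, hx⟩⟩

/-- **Murray–von Neumann equivalent idempotents generate isomorphic left ideals**: if `c ∈ eAf`, `c' ∈ fAe`, `c c' = e`,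
`c' c = f`, then `x ↦ x c` is an `A`-linear isomorphism `A·e ⥲ A·f` with inverse `y ↦ y c'`. [folklore] -/
theorem nonempty_linearEquiv_span_of_equivalent {e f c c' : A} (he : e * e = e) (hf : f * f = f) (hc : e * c * f = c)
    (hc' : f * c' * e = c') (hcc' : c * c' = e) (hc'c : c' * c = f) :
    Nonempty (Ideal.span ({e} : Set A) ≃ₗ[A] Ideal.span ({f} : Set A)) := by
  have hcf : c * f = c := by rw [← hc, mul_assoc (e * c), hf]
  have hc'e : c' * e = c' := by rw [← hc', mul_assoc (f * c'), he]
  refine ⟨{ toFun := fun x ↦ ⟨x.1 * c, (mem_span_singleton_of_idem hf).2 (by rw [mul_assoc, hcf])⟩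
            map_add' := fun x y ↦ Subtype.ext (add_mul _ _ _)
            map_smul' := fun r x ↦ Subtype.ext (mul_assoc r x.1 c)
            invFun := fun y ↦ ⟨y.1 * c', (mem_span_singleton_of_idem he).2 (by rw [mul_assoc, hc'e])⟩
            left_inv := fun x ↦ Subtype.ext ?_
            right_inv := fun y ↦ Subtype.ext ?_ }⟩
  · change x.1 * c * c' = x.1
    rw [mul_assoc, hcc', (mem_span_singleton_of_idem he).1 x.2]
  · change y.1 * c' * c = y.1
    rw [mul_assoc, hc'c, (mem_span_singleton_of_idem hf).1 y.2]

/-- For ORTHOGONAL idempotents `e, f` the left ideal of `e + f` is `A·e × A·f` (`z ↦ (z e, z f)`, `(x, y) ↦ x + y`).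
[folklore] -/
theorem nonempty_linearEquiv_prod_span {e f : A} (he : e * e = e) (hf : f * f = f) (hef : e * f = 0) (hfe : f * e = 0) :
    Nonempty ((Ideal.span ({e} : Set A) × Ideal.span ({f} : Set A)) ≃ₗ[A] Ideal.span ({e + f} : Set A)) := by
  have hs : (e + f) * (e + f) = e + f := by
    rw [add_mul, mul_add, mul_add, he, hf, hef, hfe, add_zero, zero_add]
  have hxe : ∀ x : Ideal.span ({e} : Set A), x.1 * e = x.1 := fun x ↦ (mem_span_singleton_of_idem he).1 x.2
  have hyf : ∀ y : Ideal.span ({f} : Set A), y.1 * f = y.1 := fun y ↦ (mem_span_singleton_of_idem hf).1 y.2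
  have hxf : ∀ x : Ideal.span ({e} : Set A), x.1 * f = 0 := fun x ↦ by rw [← hxe x, mul_assoc, hef, mul_zero]
  have hye : ∀ y : Ideal.span ({f} : Set A), y.1 * e = 0 := fun y ↦ by rw [← hyf y, mul_assoc, hfe, mul_zero]
  have hz : ∀ z : Ideal.span ({e + f} : Set A), z.1 * (e + f) = z.1 := fun z ↦ (mem_span_singleton_of_idem hs).1 z.2
  refine ⟨{ toFun := fun xy ↦ ⟨xy.1.1 + xy.2.1, (mem_span_singleton_of_idem hs).2 ?_⟩
            map_add' := fun xy xy' ↦ Subtype.ext ?_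
            map_smul' := fun r xy ↦ Subtype.ext ?_
            invFun := fun z ↦ (⟨z.1 * e, (mem_span_singleton_of_idem he).2 (by rw [mul_assoc, he])⟩,
              ⟨z.1 * f, (mem_span_singleton_of_idem hf).2 (by rw [mul_assoc, hf])⟩)
            left_inv := fun xy ↦ ?_
            right_inv := fun z ↦ Subtype.ext ?_ }⟩
  · rw [add_mul, mul_add, mul_add, hxe, hxf, hye, hyf, add_zero, zero_add]
  · change (xy.1.1 + xy'.1.1) + (xy.2.1 + xy'.2.1) = (xy.1.1 + xy.2.1) + (xy'.1.1 + xy'.2.1)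
    abel
  · change r * xy.1.1 + r * xy.2.1 = r * (xy.1.1 + xy.2.1)
    rw [mul_add]
  · refine Prod.ext (Subtype.ext ?_) (Subtype.ext ?_)
    · change (xy.1.1 + xy.2.1) * e = xy.1.1
      rw [add_mul, hxe, hye, add_zero]
    · change (xy.1.1 + xy.2.1) * f = xy.2.1
      rw [add_mul, hxf, hyf, zero_add]
  · change z.1 * e + z.1 * f = z.1
    rw [← mul_add, hz]

variable [FiniteDimensional k A]

/-- **Additivity of the trace character of left ideals**: `Tr_{A(e+f)}(r) = Tr_{Ae}(r) + Tr_{Af}(r)` for orthogonal idempotents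
`e, f` and every `r ∈ A` (acting by left multiplication). [cite: BourbakiAlgebreVIII2012, VIII § 20 n° 6 (p. 375)] -/
theorem trace_smul_span_add {e f : A} (he : e * e = e) (hf : f * f = f) (hef : e * f = 0) (hfe : f * e = 0) (r : A) :
    LinearMap.trace k _ (DistribSMul.toLinearMap k (Ideal.span ({e + f} : Set A)) r) =
      LinearMap.trace k _ (DistribSMul.toLinearMap k (Ideal.span ({e} : Set A)) r) +
        LinearMap.trace k _ (DistribSMul.toLinearMap k (Ideal.span ({f} : Set A)) r) := by
  haveI := Module.finiteDimensional_submodule_tower (k := k) (Ideal.span ({e} : Set A))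
  haveI := Module.finiteDimensional_submodule_tower (k := k) (Ideal.span ({f} : Set A))
  haveI := Module.finiteDimensional_submodule_tower (k := k) (Ideal.span ({e + f} : Set A))
  obtain ⟨Ψ⟩ := nonempty_linearEquiv_prod_span he hf hef hfe
  rw [← Module.trace_smul_eq_of_linearEquiv (k := k) Ψ r]
  have h : DistribSMul.toLinearMap k (Ideal.span ({e} : Set A) × Ideal.span ({f} : Set A)) r =
      (DistribSMul.toLinearMap k (Ideal.span ({e} : Set A)) r).prodMap
        (DistribSMul.toLinearMap k (Ideal.span ({f} : Set A)) r) := by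
    apply LinearMap.ext
    rintro ⟨x, y⟩
    rfl
  rw [h, LinearMap.trace_prodMap']

/-- **CANCELLATION OF EQUIVALENT IDEMPOTENTS (via Brauer–Nesbitt).** Let `A` be a finite-dimensional semisimple algebra over a
field `k` of characteristic `0`; `E ⊒ e₀, e₂` and `F ⊒ f₀, f₂` idempotents with `e₀ ⊥ e₂`, `f₀ ⊥ f₂` (so that
`e₁ := E - e₀ - e₂`, `f₁ := F - f₀ - f₂` complete orthogonal decompositions), and suppose Murray–von Neumann equivalences
`E ~ F`, `e₀ ~ f₂`, `e₂ ~ f₀`. Then `e₁ ~ f₁`: there are `x ∈ e₁ A f₁`, `y ∈ f₁ A e₁` with `x y = e₁`, `y x = f₁`. Proof: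
trace characters of the left ideals are additive (`trace_smul_span_add`) and invariant under equivalence, so
`Tr_{Ae₁} = Tr_{Af₁}`; Bourbaki VIII §20 n°6 Cor. a) (the tree's `Module.nonempty_linearEquiv_of_trace_smul_eq`) gives
`Ae₁ ≅ Af₁`, and the images of the generators are `x`, `y`. [cite: BourbakiAlgebreVIII2012, VIII § 20 n° 6, Cor. a) de la Prop. 6 (pp. 375–376)] -/
theorem exists_equivalent_middle_of_traces [CharZero k] [IsSemisimpleRing A] {E e₀ e₂ F f₀ f₂ : A}
    (hE : E * E = E) (he₀ : e₀ * e₀ = e₀) (he₂ : e₂ * e₂ = e₂) (hEe₀ : E * e₀ = e₀) (he₀E : e₀ * E = e₀)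
    (hEe₂ : E * e₂ = e₂) (he₂E : e₂ * E = e₂) (he₀₂ : e₀ * e₂ = 0) (he₂₀ : e₂ * e₀ = 0)
    (hF : F * F = F) (hf₀ : f₀ * f₀ = f₀) (hf₂ : f₂ * f₂ = f₂) (hFf₀ : F * f₀ = f₀) (hf₀F : f₀ * F = f₀)
    (hFf₂ : F * f₂ = f₂) (hf₂F : f₂ * F = f₂) (hf₀₂ : f₀ * f₂ = 0) (hf₂₀ : f₂ * f₀ = 0)
    (hEF : ∃ c c' : A, E * c * F = c ∧ F * c' * E = c' ∧ c * c' = E ∧ c' * c = F)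
    (h₀₂ : ∃ c c' : A, e₀ * c * f₂ = c ∧ f₂ * c' * e₀ = c' ∧ c * c' = e₀ ∧ c' * c = f₂)
    (h₂₀ : ∃ c c' : A, e₂ * c * f₀ = c ∧ f₀ * c' * e₂ = c' ∧ c * c' = e₂ ∧ c' * c = f₀) :
    ∃ x y : A, (E - e₀ - e₂) * x * (F - f₀ - f₂) = x ∧ (F - f₀ - f₂) * y * (E - e₀ - e₂) = y ∧
      x * y = E - e₀ - e₂ ∧ y * x = F - f₀ - f₂ := by
  -- the middle idempotents
  set e₁ : A := E - e₀ - e₂ with he₁def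
  set f₁ : A := F - f₀ - f₂ with hf₁def
  have he₁ : e₁ * e₁ = e₁ := by
    have h : (E - e₀ - e₂) * (E - e₀ - e₂) = E * E - E * e₀ - E * e₂ - e₀ * E + e₀ * e₀ + e₀ * e₂ - e₂ * E + e₂ * e₀ +
        e₂ * e₂ := by noncomm_ring
    rw [he₁def, h, hE, hEe₀, hEe₂, he₀E, he₀, he₀₂, he₂E, he₂₀, he₂]; abel
  have hf₁ : f₁ * f₁ = f₁ := by
    have h : (F - f₀ - f₂) * (F - f₀ - f₂) = F * F - F * f₀ - F * f₂ - f₀ * F + f₀ * f₀ + f₀ * f₂ - f₂ * F + f₂ * f₀ +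
        f₂ * f₂ := by noncomm_ring
    rw [hf₁def, h, hF, hFf₀, hFf₂, hf₀F, hf₀, hf₀₂, hf₂F, hf₂₀, hf₂]; abel
  -- `E = (e₀ + e₁) + e₂` with the needed orthogonality relations
  have he₀₁ : e₀ * e₁ = 0 := by rw [he₁def, mul_sub, mul_sub, he₀E, he₀, he₀₂]; abel
  have he₁₀ : e₁ * e₀ = 0 := by rw [he₁def, sub_mul, sub_mul, hEe₀, he₀, he₂₀]; abel
  have he₁₂ : e₁ * e₂ = 0 := by rw [he₁def, sub_mul, sub_mul, hEe₂, he₀₂, he₂]; abel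
  have he₂₁ : e₂ * e₁ = 0 := by rw [he₁def, mul_sub, mul_sub, he₂E, he₂₀, he₂]; abel
  have hs₀₁ : (e₀ + e₁) * (e₀ + e₁) = e₀ + e₁ := by
    rw [add_mul, mul_add, mul_add, he₀, he₀₁, he₁₀, he₁, add_zero, zero_add]
  have hs₀₁₂ : (e₀ + e₁) * e₂ = 0 := by rw [add_mul, he₀₂, he₁₂, add_zero]
  have hs₂₀₁ : e₂ * (e₀ + e₁) = 0 := by rw [mul_add, he₂₀, he₂₁, add_zero]
  have hEsum : E = e₀ + e₁ + e₂ := by rw [he₁def]; abel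
  have hf₀₁ : f₀ * f₁ = 0 := by rw [hf₁def, mul_sub, mul_sub, hf₀F, hf₀, hf₀₂]; abel
  have hf₁₀ : f₁ * f₀ = 0 := by rw [hf₁def, sub_mul, sub_mul, hFf₀, hf₀, hf₂₀]; abel
  have hf₁₂ : f₁ * f₂ = 0 := by rw [hf₁def, sub_mul, sub_mul, hFf₂, hf₀₂, hf₂]; abel
  have hf₂₁ : f₂ * f₁ = 0 := by rw [hf₁def, mul_sub, mul_sub, hf₂F, hf₂₀, hf₂]; abel
  have ht₀₁ : (f₀ + f₁) * (f₀ + f₁) = f₀ + f₁ := by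
    rw [add_mul, mul_add, mul_add, hf₀, hf₀₁, hf₁₀, hf₁, add_zero, zero_add]
  have ht₀₁₂ : (f₀ + f₁) * f₂ = 0 := by rw [add_mul, hf₀₂, hf₁₂, add_zero]
  have ht₂₀₁ : f₂ * (f₀ + f₁) = 0 := by rw [mul_add, hf₂₀, hf₂₁, add_zero]
  have hFsum : F = f₀ + f₁ + f₂ := by rw [hf₁def]; abel
  -- trace characters of the left ideals
  haveI hfd : ∀ g : A, FiniteDimensional k (Ideal.span ({g} : Set A)) := fun g ↦
    Module.finiteDimensional_submodule_tower (k := k) (Ideal.span ({g} : Set A))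
  set T : A → A → k := fun g r ↦ LinearMap.trace k _ (DistribSMul.toLinearMap k (Ideal.span ({g} : Set A)) r) with hT
  have hTE : ∀ r, T E r = T e₀ r + T e₁ r + T e₂ r := fun r ↦ by
    simp only [hT]
    rw [hEsum, trace_smul_span_add hs₀₁ he₂ hs₀₁₂ hs₂₀₁, trace_smul_span_add he₀ he₁ he₀₁ he₁₀]
  have hTF : ∀ r, T F r = T f₀ r + T f₁ r + T f₂ r := fun r ↦ by
    simp only [hT]
    rw [hFsum, trace_smul_span_add ht₀₁ hf₂ ht₀₁₂ ht₂₀₁, trace_smul_span_add hf₀ hf₁ hf₀₁ hf₁₀]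
  have hequiv : ∀ {g g' : A}, g * g = g → g' * g' = g' →
      (∃ c c' : A, g * c * g' = c ∧ g' * c' * g = c' ∧ c * c' = g ∧ c' * c = g') → ∀ r, T g r = T g' r := by
    intro g g' hg hg' ⟨c, c', hc, hc', hcc', hc'c⟩ r
    obtain ⟨Ψ⟩ := nonempty_linearEquiv_span_of_equivalent hg hg' hc hc' hcc' hc'c
    exact Module.trace_smul_eq_of_linearEquiv (k := k) Ψ r
  have h₁ : ∀ r, T e₁ r = T f₁ r := fun r ↦ by
    have h1 := hequiv hE hF hEF r
    have h2 := hequiv he₀ hf₂ h₀₂ r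
    have h3 := hequiv he₂ hf₀ h₂₀ r
    rw [hTE, hTF, h2, h3] at h1
    linear_combination h1
  -- Bourbaki / Brauer–Nesbitt: equal characters ⟹ isomorphic (semisimple, characteristic zero)
  obtain ⟨Ψ⟩ := Module.nonempty_linearEquiv_of_trace_smul_eq (k := k) (R := A) (M := Ideal.span ({e₁} : Set A))
    (N := Ideal.span ({f₁} : Set A)) h₁
  set u : Ideal.span ({e₁} : Set A) := ⟨e₁, (mem_span_singleton_of_idem he₁).2 he₁⟩ with hu
  set v : Ideal.span ({f₁} : Set A) := ⟨f₁, (mem_span_singleton_of_idem hf₁).2 hf₁⟩ with hv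
  set x : A := (Ψ u).1 with hxdef
  set y : A := (Ψ.symm v).1 with hydef
  have hxf : x * f₁ = x := (mem_span_singleton_of_idem hf₁).1 (Ψ u).2
  have hye : y * e₁ = y := (mem_span_singleton_of_idem he₁).1 (Ψ.symm v).2
  have heu : e₁ • u = u := Subtype.ext (by change e₁ * e₁ = e₁; exact he₁)
  have hfv : f₁ • v = v := Subtype.ext (by change f₁ * f₁ = f₁; exact hf₁)
  have hex : e₁ * x = x := by
    have h := congrArg Subtype.val (Ψ.map_smul e₁ u)
    rw [heu] at h
    exact h.symm
  have hfy : f₁ * y = y := by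
    have h := congrArg Subtype.val (Ψ.symm.map_smul f₁ v)
    rw [hfv] at h
    exact h.symm
  have hΨu : Ψ u = x • v := Subtype.ext (by change x = x * f₁; exact hxf.symm)
  have hΨv : Ψ.symm v = y • u := Subtype.ext (by change y = y * e₁; exact hye.symm)
  have hxy : x * y = e₁ := by
    have h : u = x • Ψ.symm v := by rw [← Ψ.symm.map_smul, ← hΨu, Ψ.symm_apply_apply]
    have h' := congrArg Subtype.val h
    exact h'.symm
  have hyx : y * x = f₁ := by
    have h : v = y • Ψ u := by rw [← Ψ.map_smul, ← hΨv, Ψ.apply_symm_apply]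
    have h' := congrArg Subtype.val h
    exact h'.symm
  refine ⟨x, y, ?_, ?_, hxy, hyx⟩
  · rw [hex, hxf]
  · rw [hfy, hye]

end Algebra

end Summit.HodgeConjecture.HodgeConjecture.Theorems

end
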